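import Literature.NumberTheory.Sieve.ParityBatemanHorn
import Literature.NumberTheory.Sieve.LinearEquationsInPrimes
import HarnessLib

/-!
# Parity / BatemanHorn — sub-problem statement (D-0017)

Moved out of `Summits/Parity/Statement.lean` with the declaration text unchanged.
-/

/-- Conjunct `BatemanHorn` of `Parity`: the Literature statement `Literature.NumberTheory.Sieve.BatemanHornConjecture`
(Bateman–Horn 1962, (1)), imported not restated. [cite: BatemanHorn1962, (1)] [problem: parity] -/
abbrev BatemanHorn : Prop := Literature.NumberTheory.Sieve.BatemanHornConjecture
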